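/-
Copyright: the b2b-balaban T⁴-continuum CRUX team, row NE7b OWNER lineage `t4-ne7b-p1` (gen 136). Project licence.
-/
import Literature.Analysis.Matrix.FiniteRangeDecomposition
import Summits.QuantumFields.BalabanUV.T4Continuum.Spine.NE7b.SupDressedMeanShift

/-!
# FINITE RANGE IS LOST BY DRESSING, EXPONENTIAL DECAY SURVIVES — (α4), THE DRESSED COVARIANCE'S OFF-DIAGONAL LETTER: if the next
# fluctuation covariance `S ≻ 0` has finite range `ρ_S` and operator letter `‖Sv‖ ≤ γ′‖v‖`, and the extracted quadratic part `K` is symmetric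
# with finite range `ρ_K`, operator letter `‖Kv‖ ≤ k′‖v‖` and lower letter `K + k·1 ⪰ 0`, `kγ′ < 1`, then the DRESSED covariance
# `S′ = (S⁻¹+K)⁻¹` satisfies, for every `N`, the exact truncated Neumann identity
#   `S′ = Σ_{n≤N} (−SK)ⁿS + (−SK)^{N+1}S′`,
# whose finite part has range `≤ N(ρ_S+ρ_K) + ρ_S`; hence for sites at distance `d(x,y) > N(ρ_S+ρ_K) + ρ_S`
#   `|S′(x,y)| ≤ (γ′k′)^{N+1} · γ′∕(1−kγ′)`
# — EXPONENTIAL off-diagonal decay at rate `|log(γ′k′)|` per `ρ_S + ρ_K` when `γ′k′ < 1`: the cluster expansion downstream must run on a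
# decaying, not finite-range, covariance (row NE7b, node U5c; (387)∕(392) + `FiniteRangeDecomposition` + `GaussianToolkit` BY NAME; [folklore])

Cell `pub-balaban`, sub-cell `t4`, spine estimate NE7b (`T4WeightBudget.RelWeightBound`; the cell's OWN estimate — NOT PRINTED in
[Bałaban 1983–89], NOT PROVED).  Crux-route work under `Spine/NE7b/` by the row OWNER (`t4-ne7b-p1` gen 136, file (393)) under FREEZE
(0)'s crux-prover clause, on this gen's SCOPING-d8 DECISION (2) («(β3) finite range is LOST by any dressing; carry the decay instead»);
NOTHING of Bałaban's is named as a Lean object, valued or asserted; no `T4Continuum/Support` leaf typed; no `def`, no notation; zero `sorry`.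
Imports (BY NAME): the tree's `Literature.Analysis.Matrix.FiniteRangeDecomposition` (`HasFiniteRange` with `mul`∕`pow`∕`sum`∕`mono`∕`smul`),
`GaussianToolkit` (`dotProduct_mulVec_sq_le`, `norm_toLp_single`), the OWNER's (392) `…SupDressedMeanShift` (`dressed_shift_norm_le`,
`norm_toLp_sq_eq_dot`), (387) (`form_le_of_sub_posSemidef`, `dressed_precision_posDef`).

WHAT IS PROVED ([folklore]):
* §1 operator letters from order letters: **`opBound_of_psd_le`** (`0 ⪯ S ⪯ γ·1 ⟹ ‖Sv‖ ≤ γ‖v‖`, Cauchy–Schwarz for the `S`-form),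
  `opBound_comp` (products multiply letters), `opBound_pow_mul`, `abs_apply_le_norm` (`|u_x| ≤ ‖u‖`), **`abs_entry_le_of_opBound`**
  (`‖Mv‖ ≤ c‖v‖ ⟹ |M(x,y)| ≤ c`);
* §2 **`dressed_neumann_truncated`** (`S′ = Σ_{n≤N}(−SK)ⁿS + (−SK)^{N+1}S′`, exact), `hasFiniteRange_neg`, **`hasFiniteRange_neumann_part`**
  (the finite part has range `N(ρ_S+ρ_K)+ρ_S`);
* §3 THE END **`dressed_covariance_decay`**: `d(x,y) > N(ρ_S+ρ_K)+ρ_S ⟹ |S′(x,y)| ≤ (γ′k′)^{N+1}·γ′∕(1−kγ′)`; §4 toy.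

HONEST (what this is NOT).  Finite-dimensional matrix analysis; `k′` (an operator letter for `K_D`) is supplied on the road by (388)'s two
letters (`‖K_Dv‖ ≤ (Λ_w + 2λ_w)‖v‖`-type, the successor's one-liner) and `γ′k′ < 1` is a SMALLNESS hypothesis; the polymer expansion with a
DECAYING (not finite-range) covariance is NOT typed here — it is the located gap (β3′); scalar skeleton ((A3), NC-NE7b-α UNRULED); nothing of
Bałaban's asserted.  BY-NAME EFFECT ON THE WALL: NONE.  NE7b NOT PRINTED ∕ NOT PROVED; spine PROVED 0∕9; rung (B)+1 — the programme's measures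
remain FINITE-torus statements; NOT the mass gap, NOT Clay.  HONEST DEPENDENCY: continuum YM on T⁴ ⇐ BetaPertH ∧ nine spine estimates (0∕9
proved); BetaPertH ⇐ (D1) ∧ (D4) ∧ CAP+tail; G-an2-4 gates asym, D1 and NE2∕3∕4.
-/

set_option autoImplicit false

noncomputable section

namespace Summit.QuantumFields.BalabanUV.T4Continuum.NE7b.SupDressedCovarianceDecay

open Matrix Finset
open scoped BigOperators
open Literature.Analysis.Matrix (HasFiniteRange)
open Literature.MathematicalPhysics.QuantumFieldTheory.GaussianToolkit (dotProduct_mulVec_sq_le norm_toLp_single)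
open SupDressedMeanShift (dressed_shift_norm_le norm_toLp_sq_eq_dot)
open SupDressedCovarianceLetters (form_le_of_sub_posSemidef dressed_precision_posDef)

variable {ι : Type} [Fintype ι] [DecidableEq ι]

/-! ## §1. Operator letters from order letters; entries from operator letters -/

/-- **`0 ⪯ S ⪯ γ·1 ⟹ ‖Sv‖ ≤ γ‖v‖`** (`‖Sv‖² = vᵀS(Sv) ≤ √(vᵀSv)·√((Sv)ᵀS(Sv)) ≤ γ‖v‖·‖Sv‖`). [folklore] -/
theorem opBound_of_psd_le {S : Matrix ι ι ℝ} {γ : ℝ} (hS : S.PosSemidef) (hSγ : (γ • (1 : Matrix ι ι ℝ) - S).PosSemidef) (hγ : 0 ≤ γ)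
    (v : ι → ℝ) : ‖(WithLp.toLp 2 (S *ᵥ v) : EuclideanSpace ℝ ι)‖ ≤ γ * ‖(WithLp.toLp 2 v : EuclideanSpace ℝ ι)‖ := by
  have hSt : Sᵀ = S := by
    have h := hS.isHermitian; rwa [Matrix.IsHermitian, conjTranspose_eq_transpose_of_trivial] at h
  have hnn : ∀ u : ι → ℝ, 0 ≤ u ⬝ᵥ S *ᵥ u := fun u => by have := hS.dotProduct_mulVec_nonneg u; rwa [star_trivial] at this
  have hup : ∀ u : ι → ℝ, u ⬝ᵥ S *ᵥ u ≤ γ * (u ⬝ᵥ u) := form_le_of_sub_posSemidef hSγ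
  set a := ‖(WithLp.toLp 2 (S *ᵥ v) : EuclideanSpace ℝ ι)‖ with ha
  set b := ‖(WithLp.toLp 2 v : EuclideanSpace ℝ ι)‖ with hb
  have ha0 : 0 ≤ a := norm_nonneg _
  have hb0 : 0 ≤ b := norm_nonneg _
  -- `a² = vᵀS(Sv)`
  have hsq : a ^ 2 = v ⬝ᵥ S *ᵥ (S *ᵥ v) := by
    rw [ha, norm_toLp_sq_eq_dot, dotProduct_mulVec, ← mulVec_transpose, hSt, dotProduct_comm]
  -- Cauchy–Schwarz for the `S`-form between `v` and `Sv`
  have hcs := dotProduct_mulVec_sq_le hSt hnn v (S *ᵥ v)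
  have hvv : v ⬝ᵥ S *ᵥ v ≤ γ * b ^ 2 := by rw [hb, norm_toLp_sq_eq_dot]; exact hup v
  have hww : (S *ᵥ v) ⬝ᵥ S *ᵥ (S *ᵥ v) ≤ γ * a ^ 2 := by rw [ha, norm_toLp_sq_eq_dot]; exact hup (S *ᵥ v)
  -- `a⁴ ≤ (γb²)(γa²)` ⟹ `a ≤ γb`
  have h4 : (a ^ 2) ^ 2 ≤ (γ * b ^ 2) * (γ * a ^ 2) := by
    rw [← hsq] at hcs
    exact hcs.trans (mul_le_mul hvv hww (hnn _) (by positivity))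
  by_cases ha' : a = 0
  · rw [ha']; positivity
  · have hapos : 0 < a := lt_of_le_of_ne ha0 (Ne.symm ha')
    have h2 : a ^ 2 ≤ (γ * b) ^ 2 := by nlinarith [h4, hapos]
    exact (pow_le_pow_iff_left₀ ha0 (by positivity) two_ne_zero).1 h2

omit [DecidableEq ι] in
/-- Operator letters multiply under products: `‖Av‖ ≤ a‖v‖`, `‖Bv‖ ≤ b‖v‖`, `0 ≤ a` ⟹ `‖ABv‖ ≤ ab‖v‖`. [folklore] -/
theorem opBound_comp {A B : Matrix ι ι ℝ} {a b : ℝ} (ha : 0 ≤ a)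
    (hA : ∀ v : ι → ℝ, ‖(WithLp.toLp 2 (A *ᵥ v) : EuclideanSpace ℝ ι)‖ ≤ a * ‖(WithLp.toLp 2 v : EuclideanSpace ℝ ι)‖)
    (hB : ∀ v : ι → ℝ, ‖(WithLp.toLp 2 (B *ᵥ v) : EuclideanSpace ℝ ι)‖ ≤ b * ‖(WithLp.toLp 2 v : EuclideanSpace ℝ ι)‖) (v : ι → ℝ) :
    ‖(WithLp.toLp 2 ((A * B) *ᵥ v) : EuclideanSpace ℝ ι)‖ ≤ a * b * ‖(WithLp.toLp 2 v : EuclideanSpace ℝ ι)‖ := by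
  rw [← mulVec_mulVec, mul_assoc]
  exact (hA _).trans (mul_le_mul_of_nonneg_left (hB v) ha)

/-- Powers then a factor: `‖Tv‖ ≤ t‖v‖`, `‖Mv‖ ≤ c‖v‖`, `0 ≤ t` ⟹ `‖TⁿMv‖ ≤ tⁿc‖v‖`. [folklore] -/
theorem opBound_pow_mul {T M : Matrix ι ι ℝ} {t c : ℝ} (ht : 0 ≤ t)
    (hT : ∀ v : ι → ℝ, ‖(WithLp.toLp 2 (T *ᵥ v) : EuclideanSpace ℝ ι)‖ ≤ t * ‖(WithLp.toLp 2 v : EuclideanSpace ℝ ι)‖)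
    (hM : ∀ v : ι → ℝ, ‖(WithLp.toLp 2 (M *ᵥ v) : EuclideanSpace ℝ ι)‖ ≤ c * ‖(WithLp.toLp 2 v : EuclideanSpace ℝ ι)‖) (n : ℕ) (v : ι → ℝ) :
    ‖(WithLp.toLp 2 ((T ^ n * M) *ᵥ v) : EuclideanSpace ℝ ι)‖ ≤ t ^ n * c * ‖(WithLp.toLp 2 v : EuclideanSpace ℝ ι)‖ := by
  induction n generalizing v with
  | zero => simpa using hM v
  | succ n ih =>
    rw [pow_succ', mul_assoc T, ← mulVec_mulVec]
    calc ‖(WithLp.toLp 2 (T *ᵥ ((T ^ n * M) *ᵥ v)) : EuclideanSpace ℝ ι)‖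
        ≤ t * ‖(WithLp.toLp 2 ((T ^ n * M) *ᵥ v) : EuclideanSpace ℝ ι)‖ := hT _
      _ ≤ t * (t ^ n * c * ‖(WithLp.toLp 2 v : EuclideanSpace ℝ ι)‖) := mul_le_mul_of_nonneg_left (ih v) ht
      _ = t ^ (n + 1) * c * ‖(WithLp.toLp 2 v : EuclideanSpace ℝ ι)‖ := by ring

omit [DecidableEq ι] in
/-- `|u_x| ≤ ‖u‖` in `ℝ^ι`. [folklore] -/
theorem abs_apply_le_norm (u : ι → ℝ) (x : ι) : |u x| ≤ ‖(WithLp.toLp 2 u : EuclideanSpace ℝ ι)‖ := by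
  have h : |u x| ^ 2 ≤ ‖(WithLp.toLp 2 u : EuclideanSpace ℝ ι)‖ ^ 2 := by
    rw [norm_toLp_sq_eq_dot, sq_abs, dotProduct]
    have : u x ^ 2 = u x * u x := pow_two _
    rw [this]
    exact Finset.single_le_sum (f := fun i => u i * u i) (fun i _ => mul_self_nonneg (u i)) (Finset.mem_univ x)
  exact (pow_le_pow_iff_left₀ (abs_nonneg _) (norm_nonneg _) two_ne_zero).1 h

/-- **Entries from an operator letter**: `‖Mv‖ ≤ c‖v‖` for all `v` ⟹ `|M(x,y)| ≤ c`. [folklore] -/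
theorem abs_entry_le_of_opBound {M : Matrix ι ι ℝ} {c : ℝ}
    (hM : ∀ v : ι → ℝ, ‖(WithLp.toLp 2 (M *ᵥ v) : EuclideanSpace ℝ ι)‖ ≤ c * ‖(WithLp.toLp 2 v : EuclideanSpace ℝ ι)‖) (x y : ι) :
    |M x y| ≤ c := by
  have h1 : M x y = (M *ᵥ Pi.single y 1) x := by rw [mulVec_single_one]; rfl
  rw [h1]
  refine (abs_apply_le_norm _ x).trans ?_
  have h := hM (Pi.single y 1)
  rwa [norm_toLp_single, mul_one] at h

/-! ## §2. The truncated Neumann identity and the range of its finite part -/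

/-- **THE TRUNCATED NEUMANN IDENTITY** (exact, every `N`): `S ≻ 0`, `S⁻¹ + K ≻ 0` ⟹
`(S⁻¹+K)⁻¹ = Σ_{n≤N}(−SK)ⁿ·S + (−SK)^{N+1}·(S⁻¹+K)⁻¹`. [folklore] -/
theorem dressed_neumann_truncated {S K : Matrix ι ι ℝ} (hS : S.PosDef) (hQ : (S⁻¹ + K).PosDef) (N : ℕ) :
    (S⁻¹ + K)⁻¹ = (∑ n ∈ Finset.range (N + 1), (-(S * K)) ^ n * S) + (-(S * K)) ^ (N + 1) * (S⁻¹ + K)⁻¹ := by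
  have hSu : IsUnit S.det := (Matrix.isUnit_iff_isUnit_det _).1 hS.isUnit
  have hQu : IsUnit (S⁻¹ + K).det := (Matrix.isUnit_iff_isUnit_det _).1 hQ.isUnit
  -- the resolvent step `S′ = S − SKS′`
  have hbase : (S⁻¹ + K)⁻¹ = S - S * K * (S⁻¹ + K)⁻¹ := by
    have h1 : (S⁻¹ + K) * (S⁻¹ + K)⁻¹ = 1 := Matrix.mul_nonsing_inv _ hQu
    calc (S⁻¹ + K)⁻¹ = S * S⁻¹ * (S⁻¹ + K)⁻¹ := by rw [Matrix.mul_nonsing_inv _ hSu, Matrix.one_mul]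
      _ = S * ((S⁻¹ + K) * (S⁻¹ + K)⁻¹) - S * K * (S⁻¹ + K)⁻¹ := by
          rw [Matrix.add_mul, Matrix.mul_add, ← Matrix.mul_assoc, ← Matrix.mul_assoc, add_sub_cancel_right]
      _ = S - S * K * (S⁻¹ + K)⁻¹ := by rw [h1, Matrix.mul_one]
  induction N with
  | zero =>
    rw [zero_add, Finset.sum_range_one, pow_zero, Matrix.one_mul, pow_one, neg_mul, ← sub_eq_add_neg]
    exact hbase
  | succ N ih =>
    have hbase' : (S⁻¹ + K)⁻¹ = S + -(S * K) * (S⁻¹ + K)⁻¹ := by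
      rw [neg_mul, ← sub_eq_add_neg]; exact hbase
    have hstep : (-(S * K)) ^ (N + 1) * (S⁻¹ + K)⁻¹ = (-(S * K)) ^ (N + 1) * S + (-(S * K)) ^ (N + 1 + 1) * (S⁻¹ + K)⁻¹ := by
      conv_lhs => rw [hbase']
      rw [Matrix.mul_add, pow_succ (-(S * K)) (N + 1), Matrix.mul_assoc]
    rw [Finset.sum_range_succ, add_assoc, ← hstep]
    exact ih

omit [Fintype ι] [DecidableEq ι] in
/-- Negation keeps the range. [folklore] -/
theorem hasFiniteRange_neg {d : ι → ι → ℕ} {R : ℕ} {A : Matrix ι ι ℝ} (hA : HasFiniteRange d R A) : HasFiniteRange d R (-A) := by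
  have h := hA.smul (-1)
  rwa [neg_one_smul] at h

/-- **The finite Neumann part has range `N(ρ_S+ρ_K)+ρ_S`**. [folklore] -/
theorem hasFiniteRange_neumann_part {d : ι → ι → ℕ} (htri : ∀ i j k, d i k ≤ d i j + d j k) (hd : ∀ i, d i i = 0) {ρS ρK : ℕ}
    {S K : Matrix ι ι ℝ} (hSr : HasFiniteRange d ρS S) (hKr : HasFiniteRange d ρK K) (N : ℕ) :
    HasFiniteRange d (N * (ρS + ρK) + ρS) (∑ n ∈ Finset.range (N + 1), (-(S * K)) ^ n * S) := by
  have hT : HasFiniteRange d (ρS + ρK) (-(S * K)) := hasFiniteRange_neg (hSr.mul htri hKr)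
  refine HasFiniteRange.sum _ fun n hn => ?_
  have h := (hT.pow htri hd n).mul htri hSr
  refine h.mono ?_
  have hn' : n ≤ N := Nat.lt_succ_iff.mp (Finset.mem_range.mp hn)
  exact Nat.add_le_add_right (Nat.mul_le_mul_right _ hn') _

/-! ## §3. THE END: exponential off-diagonal decay of the dressed covariance -/

/-- **THE DRESSED COVARIANCE DECAYS OFF THE DIAGONAL.**  `S ≻ 0` with `γ′·1 − S ⪰ 0`, `0 < γ′`, finite range `ρ_S`; `K` with `K + k·1 ⪰ 0`,
`kγ′ < 1`, finite range `ρ_K` and operator letter `‖Kv‖ ≤ k′‖v‖`, `0 ≤ k′`; a pseudo-distance `d` (triangle inequality, `d(i,i) = 0`) ⟹ for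
every `N` and all `x, y` with `d(x,y) > N(ρ_S+ρ_K) + ρ_S`:  `|(S⁻¹+K)⁻¹(x,y)| ≤ (γ′k′)^{N+1} · γ′∕(1−kγ′)`. [folklore] -/
theorem dressed_covariance_decay {d : ι → ι → ℕ} (htri : ∀ i j k, d i k ≤ d i j + d j k) (hd : ∀ i, d i i = 0) {ρS ρK : ℕ}
    {S K : Matrix ι ι ℝ} {γ' k k' : ℝ} (hS : S.PosDef) (hSγ : (γ' • (1 : Matrix ι ι ℝ) - S).PosSemidef) (hγ' : 0 < γ')
    (hK : (K + k • (1 : Matrix ι ι ℝ)).PosSemidef) (hkγ : k * γ' < 1) (hk' : 0 ≤ k')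
    (hKop : ∀ v : ι → ℝ, ‖(WithLp.toLp 2 (K *ᵥ v) : EuclideanSpace ℝ ι)‖ ≤ k' * ‖(WithLp.toLp 2 v : EuclideanSpace ℝ ι)‖)
    (hSr : HasFiniteRange d ρS S) (hKr : HasFiniteRange d ρK K) (N : ℕ) {x y : ι} (hxy : N * (ρS + ρK) + ρS < d x y) :
    |(S⁻¹ + K)⁻¹ x y| ≤ (γ' * k') ^ (N + 1) * (γ' / (1 - k * γ')) := by
  have hQ := dressed_precision_posDef hS hSγ hγ' hK hkγ
  -- the entry is the tail's entry
  have hid := dressed_neumann_truncated (K := K) hS hQ N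
  have hfin := hasFiniteRange_neumann_part htri hd hSr hKr N x y hxy
  have hentry : (S⁻¹ + K)⁻¹ x y = ((-(S * K)) ^ (N + 1) * (S⁻¹ + K)⁻¹) x y := by
    conv_lhs => rw [hid]
    rw [Matrix.add_apply, hfin, zero_add]
  rw [hentry]
  -- operator letters: `‖(−SK)v‖ ≤ γ′k′‖v‖`, `‖S′v‖ ≤ γ⁺‖v‖`
  have hSop := opBound_of_psd_le hS.posSemidef hSγ hγ'.le
  have hTop : ∀ v : ι → ℝ, ‖(WithLp.toLp 2 ((-(S * K)) *ᵥ v) : EuclideanSpace ℝ ι)‖ ≤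
      γ' * k' * ‖(WithLp.toLp 2 v : EuclideanSpace ℝ ι)‖ := fun v => by
    rw [neg_mulVec, WithLp.toLp_neg, norm_neg]
    exact opBound_comp hγ'.le hSop hKop v
  have hS'op : ∀ v : ι → ℝ, ‖(WithLp.toLp 2 ((S⁻¹ + K)⁻¹ *ᵥ v) : EuclideanSpace ℝ ι)‖ ≤
      γ' / (1 - k * γ') * ‖(WithLp.toLp 2 v : EuclideanSpace ℝ ι)‖ := dressed_shift_norm_le hS hSγ hγ' hK hkγ
  exact abs_entry_le_of_opBound (opBound_pow_mul (by positivity) hTop hS'op (N + 1)) x y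

/-! ## §4. Toy -/

/-- Toy (§1): the identity matrix has operator letter `1`. -/
example (v : ι → ℝ) : ‖(WithLp.toLp 2 ((1 : Matrix ι ι ℝ) *ᵥ v) : EuclideanSpace ℝ ι)‖ ≤ 1 * ‖(WithLp.toLp 2 v : EuclideanSpace ℝ ι)‖ := by
  rw [one_mulVec, one_mul]

end Summit.QuantumFields.BalabanUV.T4Continuum.NE7b.SupDressedCovarianceDecay
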